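import Summits.QuantumFields.YangMills.Theses.ThermalTraceWindow
import Summits.QuantumFields.YangMills.Theorems.LuscherReductionOneSiteLevelsClosed
import HarnessLib

/-!
# BC5 rung of `ThermalTraceWindow.SubFemtoFirstLevel` (item stmt-QuantumFields-28291): the `L = 1` instance — PROVED

K2a of route `ThermalTraceWindow` (LINE g8-B of seat ym-idea-4) asks, uniformly in the sub-femto window `L₀ ≤ L ≤ β^A`, that the first
zero-flux transfer level is not split off: `β^{-k} λ₀(β,L)^L ≤ λ₁(β,L)^L`.  At the bottom of the window, `L = 1` (the one-point torus,
Lüscher's quantum mechanics of the three holonomies), the PROVED crux `LuscherReduction.OneSiteLevels` (`oneSiteLevels_proof`, k = 1) gives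
`μ₁(B) ≥ e^{−(Δ₁λ_b + Cλ_b²)} μ₀(B)` with `λ_b = (2/B)^{1/3} ≤ 2^{1/3}` for `B ≥ 1`, hence `μ₁ ≥ e^{−M} μ₀ ≥ B^{-1} μ₀` once `log B ≥ M`:
the `L = 1` case of K2a with `k = 1` (`subFemtoFirstLevel_rung_one`).  This is the witness-of-weakness rung (D-0033 T3): a decided instance of
the crux in a regime where the rung `XiSuperPolySU2` says nothing (it is an `L → ∞` statement), exercising exactly the line's lever
(two populated zero-flux levels).

HONEST FRAMING: one-site spectral bookkeeping; not K2a (no uniformity in `L`), no RG, no summit.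
-/

open Summit.QuantumFields.YangMills.Theorems
open Summit.QuantumFields.YangMills.Theorems.FemtoTransferGap

namespace Summit.QuantumFields.YangMills.Theses.ThermalTraceWindow

/-- **K2a at `L = 1`**: `∃ k β₀, ∀ β ≥ β₀, β^{-k} λ₀(β,1) ≤ λ₁(β,1)` (here `k = 1`). -/
theorem subFemtoFirstLevel_rung_one :
    ∃ k β₀ : ℝ, ∀ β : ℝ, β₀ ≤ β →
      β ^ (-k) * levelValue su2Rep 1 β 0 ^ (1 : ℕ) ≤ levelValue su2Rep 1 β 1 ^ (1 : ℕ) := by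
  obtain ⟨C, B0, h⟩ := oneSiteLevels_proof 1
  -- a uniform bound `M` on the exponent for `β ≥ max B0 1`
  set M : ℝ := |levelGap 1| * 2 + |C| * 4 with hM
  refine ⟨1, max (max B0 1) (Real.exp M), fun β hβ => ?_⟩
  simp only [max_le_iff] at hβ
  obtain ⟨⟨hB0, hβ1⟩, hβM⟩ := hβ
  have hβpos : 0 < β := by linarith
  obtain ⟨hμ0, -, hlow⟩ := h β hB0
  simp only [pow_one]
  -- `λ_b = (2/β)^{1/3} ∈ [0, 2^{1/3}] ⊆ [0, 2]`
  have hlb0 : 0 ≤ bareLambda β := by unfold bareLambda; positivity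
  have hlb2 : bareLambda β ≤ 2 := by
    unfold bareLambda
    have h2β : 2 / β ≤ 2 := by rw [div_le_iff₀ hβpos]; linarith
    have h0 : 0 ≤ 2 / β := by positivity
    calc (2 / β) ^ ((1 : ℝ) / 3) ≤ (2 : ℝ) ^ ((1 : ℝ) / 3) := Real.rpow_le_rpow h0 h2β (by norm_num)
      _ ≤ (2 : ℝ) ^ (1 : ℝ) := Real.rpow_le_rpow_of_exponent_le (by norm_num) (by norm_num)
      _ = 2 := Real.rpow_one 2
  -- the exponent is at most `M`
  have hexpo : levelGap 1 * bareLambda β + C * bareLambda β ^ 2 ≤ M := by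
    have h1 : levelGap 1 * bareLambda β ≤ |levelGap 1| * 2 := by
      calc levelGap 1 * bareLambda β ≤ |levelGap 1| * bareLambda β :=
            mul_le_mul_of_nonneg_right (le_abs_self _) hlb0
        _ ≤ |levelGap 1| * 2 := mul_le_mul_of_nonneg_left hlb2 (abs_nonneg _)
    have h2 : C * bareLambda β ^ 2 ≤ |C| * 4 := by
      calc C * bareLambda β ^ 2 ≤ |C| * bareLambda β ^ 2 :=
            mul_le_mul_of_nonneg_right (le_abs_self _) (sq_nonneg _)
        _ ≤ |C| * 4 := mul_le_mul_of_nonneg_left (by nlinarith) (abs_nonneg _)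
    linarith
  -- `β^{-1} ≤ e^{-M} ≤ e^{-(exponent)}`
  have hβinv : β ^ (-(1 : ℝ)) ≤ Real.exp (-M) := by
    rw [Real.rpow_neg hβpos.le, Real.rpow_one, Real.exp_neg]
    exact inv_anti₀ (Real.exp_pos M) hβM
  calc β ^ (-(1 : ℝ)) * levelValue su2Rep 1 β 0
      ≤ Real.exp (-M) * levelValue su2Rep 1 β 0 := mul_le_mul_of_nonneg_right hβinv hμ0.le
    _ ≤ Real.exp (-(levelGap 1 * bareLambda β + C * bareLambda β ^ 2)) * levelValue su2Rep 1 β 0 :=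
        mul_le_mul_of_nonneg_right (Real.exp_le_exp.mpr (by linarith)) hμ0.le
    _ ≤ levelValue su2Rep 1 β 1 := hlow

/-- The rung is literally the `L = 1` slice of `SubFemtoFirstLevel`'s conclusion (same shape, `[NeZero 1]` from Mathlib). -/
theorem subFemtoFirstLevel_rung_one_shape :
    ∃ k β₀ : ℝ, ∀ β : ℝ, β₀ ≤ β → ∀ A : ℝ, 0 < A → ((1 : ℕ) : ℝ) ≤ β ^ A →
      β ^ (-k) * levelValue su2Rep 1 β 0 ^ (1 : ℕ) ≤ levelValue su2Rep 1 β 1 ^ (1 : ℕ) := by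
  obtain ⟨k, β₀, h⟩ := subFemtoFirstLevel_rung_one
  exact ⟨k, β₀, fun β hβ _ _ _ => h β hβ⟩

end Summit.QuantumFields.YangMills.Theses.ThermalTraceWindow
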